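import Literature.Analysis.Calculus.HarmonicPolynomialLaplacian
import Mathlib.Topology.ContinuousMap.StoneWeierstrass
import HarnessLib

/-!
# Polynomials are dense on the sphere; homogenization of polynomials on the sphere

Analysis support file (everything proved; one small definition, no named facts) for the
spherical-harmonics route to the sharp Poincaré inequality on spheres (A. Waldron, Invent.
math. 217 (2019), Lemma 3.5):

* `coordCM`, `polyCM` — coordinates and polynomial functions as continuous maps on the unit
  sphere of `EuclideanSpace ℝ (Fin n)`; `polyCM_apply : polyCM P θ = toFun P θ`;
* `exists_poly_near_of_continuousOn` — **Stone–Weierstrass on the sphere**: a function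
  continuous off the origin is uniformly approximated on the unit sphere by polynomials;
* `exists_homogenization` — every polynomial `P` agrees on the unit sphere with `q₁ + q₂`,
  `q₁` homogeneous of degree `N = totalDegree P`, `q₂` homogeneous of degree `N + 1`
  (multiply each homogeneous component by the appropriate power of `ρ = ∑ Xₖ²`, which is `1`
  on the sphere).

References: (Stone–Weierstrass; spherical harmonics) [folklore]; A. Waldron, Invent. math. 217
(2019), Lemma 3.5 [Waldron2019].
-/

noncomputable section

open scoped BigOperators
open MvPolynomial Metric Set

namespace Literature.Analysis.Calculus

namespace MvPoly

variable {n : ℕ}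

/-- The `i`-th coordinate as a continuous map on the unit sphere. [folklore] -/
def coordCM (i : Fin n) : C(sphere (0 : EuclideanSpace ℝ (Fin n)) 1, ℝ) :=
  ⟨fun θ => (θ : EuclideanSpace ℝ (Fin n)) i,
    (EuclideanSpace.proj (𝕜 := ℝ) (ι := Fin n) i).continuous.comp continuous_subtype_val⟩

/-- Polynomial functions on the unit sphere, as an algebra homomorphism into continuous maps.
[folklore] -/
def polyCM : MvPolynomial (Fin n) ℝ →ₐ[ℝ] C(sphere (0 : EuclideanSpace ℝ (Fin n)) 1, ℝ) :=
  MvPolynomial.aeval coordCM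

/-- `polyCM P θ = toFun P θ`. [folklore] -/
theorem polyCM_apply (P : MvPolynomial (Fin n) ℝ) (θ : sphere (0 : EuclideanSpace ℝ (Fin n)) 1) :
    polyCM P θ = toFun P (θ : EuclideanSpace ℝ (Fin n)) := by
  induction P using MvPolynomial.induction_on with
  | C a => simp [polyCM, toFun]
  | add p q hp hq => simp only [map_add, ContinuousMap.add_apply, hp, hq, toFun_add]
  | mul_X p i hp =>
    simp only [map_mul, ContinuousMap.mul_apply, hp, toFun_mul, toFun_X]
    simp [polyCM, coordCM]

/-- The polynomial functions separate the points of the sphere. [folklore] -/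
theorem polyCM_separatesPoints :
    ((polyCM : MvPolynomial (Fin n) ℝ →ₐ[ℝ] _).range : Subalgebra ℝ
      C(sphere (0 : EuclideanSpace ℝ (Fin n)) 1, ℝ)).SeparatesPoints := by
  intro θ θ' hne
  have h : ∃ i, (θ : EuclideanSpace ℝ (Fin n)) i ≠ (θ' : EuclideanSpace ℝ (Fin n)) i := by
    by_contra hall
    simp only [not_exists, not_not] at hall
    exact hne (Subtype.ext (PiLp.ext hall))
  obtain ⟨i, hi⟩ := h
  refine ⟨⇑(polyCM (X i : MvPolynomial (Fin n) ℝ)), ⟨polyCM (X i), ⟨X i, rfl⟩, rfl⟩, ?_⟩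
  simpa [polyCM, coordCM] using hi

/-- **Polynomials are uniformly dense on the sphere** (Stone–Weierstrass): for `f` continuous off
the origin and `ε > 0` there is a polynomial `P` with `|f − P| < ε` on the unit sphere.
[folklore] -/
theorem exists_poly_near_of_continuousOn {f : EuclideanSpace ℝ (Fin n) → ℝ}
    (hf : ContinuousOn f {0}ᶜ) {ε : ℝ} (hε : 0 < ε) :
    ∃ P : MvPolynomial (Fin n) ℝ, ∀ x : EuclideanSpace ℝ (Fin n), ‖x‖ = 1 → |f x - toFun P x| < ε := by
  have hc : Continuous fun θ : sphere (0 : EuclideanSpace ℝ (Fin n)) 1 => f θ :=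
    hf.comp_continuous continuous_subtype_val fun θ => by
      simp only [mem_compl_iff, mem_singleton_iff]
      exact ne_zero_of_mem_unit_sphere θ
  obtain ⟨g, hg⟩ := ContinuousMap.exists_mem_subalgebra_near_continuous_of_separatesPoints _
    polyCM_separatesPoints (fun θ : sphere (0 : EuclideanSpace ℝ (Fin n)) 1 => f θ) hc ε hε
  obtain ⟨P, hP⟩ : ∃ P, polyCM P = (g : C(sphere (0 : EuclideanSpace ℝ (Fin n)) 1, ℝ)) := by
    obtain ⟨P, hP⟩ := g.2; exact ⟨P, hP⟩
  refine ⟨P, fun x hx => ?_⟩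
  have h1 := hg ⟨x, mem_sphere_zero_iff_norm.2 hx⟩
  rw [← hP] at h1
  simp only [Real.norm_eq_abs] at h1
  rw [show ((polyCM P : C(_, ℝ)) : _ → ℝ) ⟨x, mem_sphere_zero_iff_norm.2 hx⟩ = toFun P x from
    polyCM_apply P ⟨x, _⟩] at h1
  rwa [abs_sub_comm] at h1

/-! ### Homogenization on the sphere -/

/-- Powers of `ρ` evaluate to `1` on the unit sphere. [folklore] -/
theorem toFun_rho_pow_of_norm_eq_one (j : ℕ) {x : EuclideanSpace ℝ (Fin n)} (hx : ‖x‖ = 1) :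
    toFun (rho ^ j) x = 1 := by
  induction j with
  | zero => simp [toFun]
  | succ j ih =>
    rw [pow_succ, toFun_mul, ih, one_mul]
    rw [EuclideanSpace.norm_eq] at hx
    have h2 : ∑ i, ‖x i‖ ^ 2 = 1 := by
      have := congrArg (· ^ 2) hx
      simp only [one_pow] at this
      rwa [Real.sq_sqrt (Finset.sum_nonneg fun i _ => sq_nonneg _)] at this
    simp only [rho, toFun, map_sum, map_pow, eval_X]
    simpa [Real.norm_eq_abs, sq_abs] using h2

/-- **Homogenization**: every polynomial `P` agrees on the unit sphere with `q₁ + q₂` where `q₁`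
is homogeneous of degree `N = totalDegree P` and `q₂` of degree `N + 1`. [folklore] -/
theorem exists_homogenization (P : MvPolynomial (Fin n) ℝ) :
    ∃ q₁ q₂ : MvPolynomial (Fin n) ℝ, q₁.IsHomogeneous P.totalDegree ∧
      q₂.IsHomogeneous (P.totalDegree + 1) ∧
      ∀ x : EuclideanSpace ℝ (Fin n), ‖x‖ = 1 → toFun P x = toFun q₁ x + toFun q₂ x := by
  classical
  set N := P.totalDegree with hN
  -- components of the parity of `N` go to `q₁`, the others to `q₂`
  set q₁ : MvPolynomial (Fin n) ℝ := ∑ m ∈ Finset.range (N + 1),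
    if (N - m) % 2 = 0 then homogeneousComponent m P * rho ^ ((N - m) / 2) else 0 with hq₁
  set q₂ : MvPolynomial (Fin n) ℝ := ∑ m ∈ Finset.range (N + 1),
    if (N - m) % 2 = 0 then 0 else homogeneousComponent m P * rho ^ ((N + 1 - m) / 2) with hq₂
  refine ⟨q₁, q₂, ?_, ?_, ?_⟩
  · refine IsHomogeneous.sum _ _ _ fun m hm => ?_
    rw [Finset.mem_range] at hm
    split_ifs with h
    · have h1 := (homogeneousComponent_isHomogeneous m P).mul (isHomogeneous_rho.pow ((N - m) / 2))
      rwa [show m + 2 * ((N - m) / 2) = N by omega] at h1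
    · exact isHomogeneous_zero _ _ _
  · refine IsHomogeneous.sum _ _ _ fun m hm => ?_
    rw [Finset.mem_range] at hm
    split_ifs with h
    · exact isHomogeneous_zero _ _ _
    · have h1 := (homogeneousComponent_isHomogeneous m P).mul
        (isHomogeneous_rho.pow ((N + 1 - m) / 2))
      rwa [show m + 2 * ((N + 1 - m) / 2) = N + 1 by omega] at h1
  · intro x hx
    have hsum := congrArg (fun Q => toFun Q x) (sum_homogeneousComponent (φ := P))
    simp only [toFun_sum] at hsum
    rw [← hsum, hq₁, hq₂, toFun_sum, toFun_sum, ← Finset.sum_add_distrib]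
    refine Finset.sum_congr rfl fun m _ => ?_
    split_ifs with h
    · rw [toFun_mul, toFun_rho_pow_of_norm_eq_one _ hx, toFun_zero]; ring
    · rw [toFun_mul, toFun_rho_pow_of_norm_eq_one _ hx, toFun_zero]; ring

end MvPoly

end Literature.Analysis.Calculus
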